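import Literature.Geometry.Lorentzian.StabilityCauchy
import Literature.Geometry.Lorentzian.KerrCollarConvergence
import HarnessLib

/-!
# gr.S05 with the two-sided collar: Klainerman–Szeftel, Cauchy consequence form on `{r > r₁}`

`Literature.Geometry.Lorentzian.StabilityCauchy` vendors the nonlinear stability of slowly
rotating Kerr black holes (Klainerman–Szeftel, PAMQ 19 (2023) = arXiv:2104.11857, completed by
Giorgi–Klainerman–Szeftel arXiv:2205.14808 and Shen, Ann. PDE 9 (2023) = arXiv:2205.12336) as the
named fact `klainerman_szeftel_kerr_stability_small_a_cauchy`: existential exponents `(s, δ, k)`,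
a ONE-SIDED conclusion chart on the Kerr exterior `Kerr.background M' a'` = `{r > r₊(M', a')}`
(`Spacetime.ConvergesToKerr 𝒟oc M' a' k` with an existential region `𝒟oc`), and no statement of
which side of the Cauchy hypersurface the chart lives on. This file re-vendors the SAME printed
theorem, in the same consequence-form conventions and over the vocabulary of
`Literature.Geometry.Lorentzian.KerrCollarConvergence` (`Kerr.collarBackground`,
`CauchyDevelopment.CollarConvergesToKerr`), with the three clauses the print carries and that
rendering drops (item wi-34761; each checked against the held text `paper:arxiv-2104.11857`, see
"Page check" below):

* **(a) the convergence order is handed over** — `∀ K` up front, `∃ (s, δ), ∃ a₀` after it: the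
  number of derivatives `k_large` is a free large parameter of the Main Theorem ("`k_large`
  sufficiently large", constraint `k_large ≫ 1/δ_dec`, §3.4.1), the data are assumed admissible at
  order `k_large + 10` ((3.4.7) `𝔍_{k_large+10} ≤ ε₀²`) and the conclusion (3.4.8)
  `𝔑^{(Sup)}_{k_large} + 𝔑^{(Dec)}_{k_small} + |a_∞ − a₀| + |m_∞ − m₀| ≤ C ε₀` controls
  `k_small = ⌊k_large/2⌋ + 1` derivatives with decay; so every convergence order `K` is reached by
  taking `k_large` (hence the data order `s`) large, at the cost of letting `(s, δ, a₀, ε)` depend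
  on `K` — which is exactly the quantifier prefix `∀ K, ∃ (s, δ), ∃ a₀ > 0, …` below (the smallness
  of `|a₀|/m₀` is allowed to depend on `K` too: the weaker, safe reading of "`|a₀|/m₀` sufficiently
  small, `k_large` sufficiently large, `ε₀` sufficiently small").
* **(b) the collar** — the conclusion chart lives on the TWO-SIDED Kerr–Schild region
  `Kerr.region a' r₁ = {r > max r₁ 0}` for some `r₁ ∈ (r₋(M', a'), r₊(M', a'))`, i.e. it straddles
  the future event horizon of the final Kerr solution: the near region `𝓜_int` of the printed
  spacetime is foliated by `ū` down to the spacelike boundary `𝓐 = {r = (m₀ + √(m₀² − a₀²))(1 − δ_𝓗)}`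
  (§3.2.2), the norms `^{(int)}𝔅_k`, `^{(int)}𝔇_k = sup_{𝓜_int} ū^{1+δ_dec} |𝔡^{≤k}(Γ_g, Γ_b)|` are
  suprema over all of `𝓜_int` (§3.3.3), `𝓜_int` "is covered by three regular coordinates patches"
  `(ū, r, θ, φ)`, `(ū, r, x¹, x²)` in which `g = g_{a_∞,m_∞} + O(ε₀ ū^{-1-δ_dec})` (Main Theorem,
  item 5; §3.8.4), and "`𝓜_int` contains the event horizon `𝓗₊` of a black hole in its interior …
  `𝓗₊` is actually located in the interior of the region `𝓜_int`" (§3.8.1), quantitatively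
  `r₊,∞(1 − √ε₀ ū^{-1-δ_dec}) ≤ r ≤ r₊,∞(1 + √ε₀ ū^{-1-δ_dec/2})` on `𝓗₊` (§3.8.4). With
  `r₁ := r₊(m₀, a₀)(1 − δ_𝓗)` one has `r₋(m_∞, a_∞) < r₁ < r₊(m_∞, a_∞)` because `ε₀ ≪ δ_𝓗` and
  `|a₀| ≪ m₀` (the computation `Δ_∞ ≲ −δ_𝓗 < 0` on `{r ≤ r₊(1 − δ_𝓗/2)}` of §3.8.1).
* **(c) orientation** — the chart image lies in the causal future `J⁺(ι X)` of the Cauchy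
  hypersurface: the theorem is about the FUTURE development `𝓜_∞` of the data (Def. 3.4.4:
  "a future development of the initial data set supported on `Σ₀`"; Main Theorem: "possesses an
  admissible future complete development `𝓜_∞`").

Everything else — hypotheses, data class, completeness of `𝓘⁺`, nearness of the final parameters —
is verbatim the accepted rendering `klainerman_szeftel_kerr_stability_small_a_cauchy` /
`….nearness` of `StabilityCauchy` (whose paraphrase notes apply word for word), with the modulus in
the qualitative form `∀ η > 0, ∃ ε > 0, … |M' − M| + |a' − a| ≤ η` of `….nearness` (weaker than the
printed `C ε₀` of (3.4.8); allowed).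

## Main results

* `klainerman_szeftel_kerr_stability_small_a_cauchy_collar` — the named fact (D-0014);
* `….of_le` — bookkeeping: a witness at order `K` serves every order `k ≤ K` in the same
  development, same final parameters, same collar (`CollarConvergesToKerr.of_le`);
* `….futureEventHorizon_subset` — the collar of the conclusion contains the horizon hypersurface
  `Kerr.futureEventHorizon M' a' = {r = r₊(M', a')}` of the final reference solution
  (`Kerr.futureEventHorizon_subset_collarBackground_domain`);
* `….exists_convergesToKerr` — the new fact refines the old rendering: for every `k` the
  conclusion shape of `klainerman_szeftel_kerr_stability_small_a_cauchy.nearness` (one-sided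
  `Spacetime.ConvergesToKerr 𝒟oc M' a' k`) holds, with moreover `𝒟oc ⊆ J⁺(ι X)`
  (`CollarConvergesToKerr.exists_convergesToKerr_of_le`).

## Page check (held copy `paper:arxiv-2104.11857`, corpus-tex; chunk = `pNNNN.txt`; the printed
## section number is `3.` followed by the chunk's chapter-3 numbering, as in `StabilityCauchy`)

* p0045 (§3.2.2, "Principal geodesic structure on `𝓜_int`", item 4): "The foliation by `ū` of
  `𝓜_int` terminates at the space like boundary `𝓐 = {r_int = (m₀ + √(m₀² − a₀²))(1 − δ_𝓗)}`".
* p0049 (§3.3.3, "Main norms in `𝓜_int`"): `^{(int)}𝔅_k := sup_{𝓜_int} {|𝔡^{≤k} Γ_g| + |𝔡^{≤k} Γ_b|}`,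
  `^{(int)}𝔇_k := sup_{𝓜_int} ū^{1+δ_dec} (|𝔡^{≤k} Γ_g| + |𝔡^{≤k} Γ_b|)`.
* p0051 (§3.4.1, "Smallness constants"): "`m₀` and `a₀` are fixed constants with
  `0 ≤ |a₀| < m₀`, … `r₀` and `k_large` are fixed, sufficiently large, universal constant, chosen
  such that … `k_large ≫ 1/δ_dec`", "`0 < ε₀, ε ≪ min{δ_𝓗, δ_dec, δ_tt, δ_*, 1/r₀, 1/k_large,
  m₀ − |a₀|, 1}`", "`ε₀, ε ≪ |a₀|` in the case `a₀ ≠ 0`", and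
  "`k_small = ⌊k_large/2⌋ + 1`"; Def. 3.4.2 (`(ε₀, k)`-admissible layer: `𝔍_k ≤ ε₀²`), Remark 3.4.3
  (Klainerman–Nicolò, Caciotta–Nicolò), Def. 3.4.4 (future development), Def. 3.4.5 ("The future
  null infinity `𝓘⁺` of `𝓜` is complete. The other future boundary of `𝓜` is given by the
  spacelike hypersurface `𝓐`").
* p0052 (§3.4.3, Main Theorem, version 2): hypotheses "`|a₀|/m₀` sufficiently small, `k_large`
  sufficiently large, and `ε₀ > 0` sufficiently small", (3.4.7) `𝔍_{k_large+10} ≤ ε₀²`; conclusion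
  "possesses an admissible future complete development `𝓜_∞`", (3.4.8)
  `𝔑^{(Sup)}_{k_large} + 𝔑^{(Dec)}_{k_small} + |a_∞ − a₀| + |m_∞ − m₀| ≤ C ε₀`, "On `𝓜_int,∞` we have,
  for any linearized quantity `ψ̌`, `|ψ̌| ≲ ε₀ ū^{-1-δ_dec}`. … analog statements of the above
  estimates also hold for `𝔡ᵏ` derivatives with `k ≤ k_small`".
* p0053 (Main Theorem, item 5) = p0065 (§3.8.4, "Coordinates systems on `𝓜_ext` and `𝓜_int`"):
  "`𝓜_int` is covered by three regular coordinates patches: in the `(ū, r, θ, φ)` coordinates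
  system … `g = g_{a_∞,m_∞} + (dū, dr, r dθ, r sin θ dφ)² O(ε₀ ū^{-1-δ_dec})`", likewise in
  `(ū, r, x¹, x²)`, "where in each case, `g_{a_∞,m_∞}` denotes the Kerr metric expressed in the
  corresponding coordinates system of Kerr".
* p0060 (§3.8.1, "The Penrose diagram of `𝓜`", paragraph "Existence of a future event horizon"):
  "`e₃(r) ≤ −1/2 < 0`, `e₄(r) ≲ −δ_𝓗 < 0` on `𝓜_int(r ≤ r₊(1 − δ_𝓗/2))` … Thus the past of `𝓘⁺`
  does not contain this region and hence `𝓜_int` contains the event horizon `𝓗₊` of a black hole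
  in its interior. … `𝓗₊` is actually located in the interior of the region `𝓜_int`."
* p0065–p0066 (§3.8.4, "Asymptotic of the future event horizon"):
  `r₊,∞(1 − √ε₀/ū^{1+δ_dec}) ≤ r ≤ r₊,∞(1 + √ε₀/ū^{1+δ_dec/2})` on `𝓗₊`, `r_{±,∞} := m_∞ ± √(m_∞² − a_∞²)`.

## Paraphrase notes (liberties, all inherited from `StabilityCauchy` unless marked NEW)

Initial data layer in PG/PT gauges → Cauchy data on the truncated Kerr–Schild leaf
`Kerr.slice a r₀`, `r₀ ∈ (r₋, r₊)`, via the classes of Remark 3.4.3; `a₀` uniform in `M` by scale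
invariance, `ε` depending on `(M, a, r₀)` (and here on `K, η`); existential exponents `(s, δ)`;
far-origin sojourn completeness of `𝓘⁺`; every maximal vacuum Cauchy development is covered
(Choquet-Bruhat–Geroch); the late slabs `{t* = τ}` reach the corner near spacelike infinity
outside the initial outgoing cone `{u = 1}`, where the development is controlled by the exterior
theory of Klainerman–Nicolò rather than by `𝓜_∞` (there the deviation from `g_{M',a'}` is
`O(1/r) = O(1/τ)` on the slab). NEW and specific to this file: (i) the frame bounds
`𝔑^{(Dec)}_{k_small} ≲ ε₀` (PG frame, `𝔡 = (e₃, r e₄, 𝔡̸)`) are converted into `Cᴷ`-sup bounds of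
the metric components in ingoing Kerr–Schild Cartesian coordinates, which costs a fixed number of
derivatives and the explicit Kerr-side diffeomorphism between the ingoing PG coordinates
`(ū, r, θ, φ)` of `Kerr(a_∞, m_∞)` and its Kerr–Schild coordinates (under which `r` is
`Kerr.radius a_∞`) — absorbed by `∀ K, ∃ s`; (ii) decay in `ū` on `𝓜_int` versus slabs of
`t* = x⁰`: on `{r₁ < r ≤ R}` the two time functions differ by a bounded function of `r`, so
`ū^{-1-δ_dec}`-decay gives `deviationCk → 0` along `t* → ∞`; (iii) the inner radius `r₁` is
existential (in print `r₁ = r₊(m₀, a₀)(1 − δ_𝓗)` with a small universal `δ_𝓗`; for `r₀` close to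
`r₊` one takes `δ_𝓗 < (1 − r₀/r₊)/2` as in `StabilityCauchy`), only its position strictly between
the horizons of the FINAL parameters is recorded.

## What is deliberately not here

No change to `StabilityCauchy.lean` / `KerrCollarConvergence.lean` (new names only, D-0014); no
modulus `C ε₀` / `C √dist` (the qualitative `∀ η, ∃ ε` is what the consumers use; the modulus
form stays available in `klainerman_szeftel_kerr_stability_small_a_cauchy`); no horizon-location
clause (§3.8.4) beyond `r₋ < r₁ < r₊`; no claim that the printed proof is formalised — the fact
stays a named fact. The Hintz 2026 analogue (full sub-extremal range, claim grade) is not vendored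
here (`KerrStabilitySubextremalCauchy` holds the one-sided renderings).

## References

* S. Klainerman, J. Szeftel, *Kerr stability for small angular momentum*, Pure Appl. Math. Q. 19
  (2023) 791–1678 = arXiv:2104.11857 [held: `paper:arxiv-2104.11857`]: Thm. 1.2.1; §3.2.2; §3.3.3;
  §3.4.1; Def. 3.4.2–3.4.5, Remark 3.4.3; Main Theorem (version 2), §3.4.3, (3.4.7)–(3.4.8) and
  item 5; §3.8.1; §3.8.4. Bib key `KlainermanSzeftel2023`.
* E. Giorgi, S. Klainerman, J. Szeftel, *Wave equations estimates and the nonlinear stability of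
  slowly rotating Kerr black holes*, arXiv:2205.14808. Bib key `GiorgiKlainermanSzeftel2022`.
* D. Shen, *Construction of GCM hypersurfaces in perturbations of Kerr*, Ann. PDE 9 (2023), no. 1,
  Paper 11 = arXiv:2205.12336. Bib key `Shen2023GCM`.
* M. Dafermos, I. Rodnianski, *Lectures on black holes and linear waves*, arXiv:0811.0354, §5.1
  (ingoing Kerr coordinates regular across `𝓗⁺`), Conj. 5.1. Bib key `DafermosRodnianski2008`.
-/

noncomputable section

open Set TopologicalSpace Filter
open scoped ContDiff ENNReal Manifold Topology

universe u

namespace Literature.Geometry.Lorentzian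

/-! ### gr.S05 with the collar: Klainerman–Szeftel over `VacuumCauchyDevelopment` -/

/-- **gr.S05, Cauchy consequence form WITH THE TWO-SIDED COLLAR, order handed over, oriented**
(nonlinear stability of slowly rotating Kerr; named fact, D-0014; companion of
`klainerman_szeftel_kerr_stability_small_a_cauchy` of `StabilityCauchy`, see the module docstring
for the three clauses (a)–(c) it adds and their page check). **Source.** Klainerman–Szeftel, *Kerr
stability for small angular momentum*, PAMQ 19 (2023) 791–1678 = arXiv:2104.11857, Main Theorem
(version 2), §3.4.3: for an `(ε₀, k_large + 10)`-admissible initial data layer `𝓛₀(a₀, m₀)`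
(Def. 3.4.2, (3.4.7) `𝔍_{k_large+10} ≤ ε₀²`), "with `|a₀|/m₀` sufficiently small, `k_large`
sufficiently large, and `ε₀ > 0` sufficiently small", "`𝓛₀` possesses an admissible future complete
development `𝓜_∞`" (Def. 3.4.5: complete `𝓘⁺`, other future boundary the spacelike `𝓐`) and
"there exist constants `(a_∞, m_∞)` … (3.4.8)
`𝔑^{(Sup)}_{k_large} + 𝔑^{(Dec)}_{k_small} + |a_∞ − a₀| + |m_∞ − m₀| ≤ C ε₀` where …
`k_small = ⌊k_large/2⌋ + 1`"; item 5: "`𝓜_int` is covered by three regular coordinates patches" in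
which "`g = g_{a_∞,m_∞} + (dū, dr, r dθ, r sin θ dφ)² O(ε₀ ū^{-1-δ_dec})`"; §3.2.2: "The foliation by
`ū` of `𝓜_int` terminates at the space like boundary `𝓐 = {r_int = (m₀ + √(m₀² − a₀²))(1 − δ_𝓗)}`";
§3.8.1: "`𝓜_int` contains the event horizon `𝓗₊` of a black hole in its interior". Completed by
Giorgi–Klainerman–Szeftel, arXiv:2205.14808, and Shen, Ann. PDE 9 (2023) = arXiv:2205.12336.

**Statement.** For every order `K` there are exponents `(s, δ)` and `a₀ > 0` such that for all Kerr
parameters `0 < M`, `|a| < a₀ M`, every inner radius `r₀ ∈ (r₋, r₊)` of the horizon-penetrating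
Kerr–Schild slice `Kerr.slice a r₀ = {t* = 0} ∩ {r > r₀}` and every tolerance `η > 0` there is
`ε > 0` with: for every solution `D` of the vacuum constraints on `Kerr.slice a r₀` which is
`ε`-close to the induced Kerr data `Kerr.data M a r₀` in `H^s_δ × H^{s-1}_{δ+1}`
(`dataWeightedSobolevEDist`), every maximal vacuum Cauchy development `𝒟` of `D`
(`VacuumCauchyDevelopment`, `IsMaximal`) admits SUB-EXTREMAL final parameters `(M', a')` and an
inner radius `r₁` strictly between the final horizon radii, `r₋(M', a') < r₁ < r₊(M', a')`, such
that `𝒟` has complete `𝓘⁺` as seen from the far region (`HasCompleteFutureNullInfinityFar`),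
converges in `Cᴷ`, future-oriented, to `g_{M',a'}` on the two-sided collar `{r > r₁}`
(`CauchyDevelopment.CollarConvergesToKerr … M' a' r₁ K`, `KerrCollarConvergence`), and
`|M' − M| + |a' − a| ≤ η`.

Paraphrase notes: those of `klainerman_szeftel_kerr_stability_small_a_cauchy` word for word
(initial data layer → Cauchy data via Remark 3.4.3; PG/PT gauges → Kerr–Schild leaf; `a₀` uniform in
`M` by scaling, `ε` depending on `(M, a, r₀)` and here on `(K, η)`; existential `(s, δ)`; the corner
near spacelike infinity), plus the module docstring's NEW items (i)–(iii) (frame-to-coordinate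
conversion absorbed by `∀ K, ∃ s`; `ū`- versus `t*`-slabs; `r₁` existential). The case `a₀ = 0` is
allowed in print (§3.4.1: `0 ≤ |a₀| < m₀`). Instance hypotheses `[Kerr.Facts]`, `[Kerr.SliceFacts]`
and the standing `[D.metric.HasLeviCivita]` as in `StabilityCauchy`. [cite: KlainermanSzeftel2023, Main Theorem §3.4.3 (3.4.7)–(3.4.8) and item 5; §3.2.2; §3.3.3; §3.4.1; §3.8.1; §3.8.4] -/
def klainerman_szeftel_kerr_stability_small_a_cauchy_collar [Kerr.Facts] [Kerr.SliceFacts] :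
    Prop :=
  ∀ K : ℕ, ∃ (s : ℕ) (δ : ℝ), ∃ a₀ > (0 : ℝ), ∀ (M a : ℝ) (hM : 0 < M), |a| < a₀ * M →
    ∀ r₀ ∈ Set.Ioo (Kerr.rMinus M a) (Kerr.rPlus M a), ∀ η > (0 : ℝ), ∃ ε > (0 : ℝ),
      ∀ (D : InitialDataSet 𝓘(ℝ, E3) (Kerr.slice a r₀)) [D.metric.HasLeviCivita],
        D.IsVacuumConstraintSolution →
        InitialDataSet.dataWeightedSobolevEDist s δ D (Kerr.data M a r₀ hM.le) <
          ENNReal.ofReal ε →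
        ∀ 𝒟 : VacuumCauchyDevelopment D, 𝒟.IsMaximal →
          ∃ (M' a' r₁ : ℝ), Kerr.IsSubextremal M' a' ∧
            Kerr.rMinus M' a' < r₁ ∧ r₁ < Kerr.rPlus M' a' ∧
            𝒟.HasCompleteFutureNullInfinityFar ∧
            CauchyDevelopment.CollarConvergesToKerr 𝒟.toCauchyDevelopment M' a' r₁ K ∧
            |M' - M| + |a' - a| ≤ η

/-- **Bookkeeping: a witness at order `K` serves every order `k ≤ K`** — same `(s, δ, a₀, ε)`,
same final parameters, same collar, same development (by `CollarConvergesToKerr.of_le`; e.g. the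
order-`3` instance consumed by collar-pinning arguments is `h 3`, and it also yields orders `≤ 3`).
Klainerman–Szeftel 2023, (3.4.8) (estimates for all `k ≤ k_small`). [cite: KlainermanSzeftel2023, (3.4.8)] -/
theorem klainerman_szeftel_kerr_stability_small_a_cauchy_collar.of_le [Kerr.Facts]
    [Kerr.SliceFacts] (h : klainerman_szeftel_kerr_stability_small_a_cauchy_collar) {k K : ℕ}
    (hk : k ≤ K) :
    ∃ (s : ℕ) (δ : ℝ), ∃ a₀ > (0 : ℝ), ∀ (M a : ℝ) (hM : 0 < M), |a| < a₀ * M →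
      ∀ r₀ ∈ Set.Ioo (Kerr.rMinus M a) (Kerr.rPlus M a), ∀ η > (0 : ℝ), ∃ ε > (0 : ℝ),
        ∀ (D : InitialDataSet 𝓘(ℝ, E3) (Kerr.slice a r₀)) [D.metric.HasLeviCivita],
          D.IsVacuumConstraintSolution →
          InitialDataSet.dataWeightedSobolevEDist s δ D (Kerr.data M a r₀ hM.le) <
            ENNReal.ofReal ε →
          ∀ 𝒟 : VacuumCauchyDevelopment D, 𝒟.IsMaximal →
            ∃ (M' a' r₁ : ℝ), Kerr.IsSubextremal M' a' ∧
              Kerr.rMinus M' a' < r₁ ∧ r₁ < Kerr.rPlus M' a' ∧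
              𝒟.HasCompleteFutureNullInfinityFar ∧
              CauchyDevelopment.CollarConvergesToKerr 𝒟.toCauchyDevelopment M' a' r₁ K ∧
              CauchyDevelopment.CollarConvergesToKerr 𝒟.toCauchyDevelopment M' a' r₁ k ∧
              |M' - M| + |a' - a| ≤ η := by
  obtain ⟨s, δ, a₀, ha₀, H⟩ := h K
  refine ⟨s, δ, a₀, ha₀, fun M a hM ha r₀ hr₀ η hη ↦ ?_⟩
  obtain ⟨ε, hε, Hε⟩ := H M a hM ha r₀ hr₀ η hη
  refine ⟨ε, hε, fun D _ hvac hdist 𝒟 hmax ↦ ?_⟩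
  obtain ⟨M', a', r₁, hsub, hrm, hrp, hfar, hcol, hpar⟩ := Hε D hvac hdist 𝒟 hmax
  exact ⟨M', a', r₁, hsub, hrm, hrp, hfar, hcol, hcol.of_le hk, hpar⟩

/-- **The collar contains the final event-horizon hypersurface**: under the fact, the reference
horizon `Kerr.futureEventHorizon M' a' = {r = r₊(M', a')}` of the final Kerr solution lies inside
the chart region `Kerr.region a' r₁` of the conclusion (from `r₁ < r₊(M', a')`, sub-extremality and
`Kerr.futureEventHorizon_subset_collarBackground_domain`) — the formal shadow of "`𝓗₊` is
actually located in the interior of the region `𝓜_int`" (Klainerman–Szeftel 2023, §3.8.1; §3.8.4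
for its asymptotic location). [cite: KlainermanSzeftel2023, §3.8.1] -/
theorem klainerman_szeftel_kerr_stability_small_a_cauchy_collar.futureEventHorizon_subset
    [Kerr.Facts] [Kerr.SliceFacts] (h : klainerman_szeftel_kerr_stability_small_a_cauchy_collar)
    (K : ℕ) :
    ∃ (s : ℕ) (δ : ℝ), ∃ a₀ > (0 : ℝ), ∀ (M a : ℝ) (hM : 0 < M), |a| < a₀ * M →
      ∀ r₀ ∈ Set.Ioo (Kerr.rMinus M a) (Kerr.rPlus M a), ∀ η > (0 : ℝ), ∃ ε > (0 : ℝ),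
        ∀ (D : InitialDataSet 𝓘(ℝ, E3) (Kerr.slice a r₀)) [D.metric.HasLeviCivita],
          D.IsVacuumConstraintSolution →
          InitialDataSet.dataWeightedSobolevEDist s δ D (Kerr.data M a r₀ hM.le) <
            ENNReal.ofReal ε →
          ∀ 𝒟 : VacuumCauchyDevelopment D, 𝒟.IsMaximal →
            ∃ (M' a' r₁ : ℝ), Kerr.IsSubextremal M' a' ∧
              Kerr.futureEventHorizon M' a' ⊆ ((Kerr.collarBackground M' a' r₁).domain : Set E4) ∧
              CauchyDevelopment.CollarConvergesToKerr 𝒟.toCauchyDevelopment M' a' r₁ K ∧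
              |M' - M| + |a' - a| ≤ η := by
  obtain ⟨s, δ, a₀, ha₀, H⟩ := h K
  refine ⟨s, δ, a₀, ha₀, fun M a hM ha r₀ hr₀ η hη ↦ ?_⟩
  obtain ⟨ε, hε, Hε⟩ := H M a hM ha r₀ hr₀ η hη
  refine ⟨ε, hε, fun D _ hvac hdist 𝒟 hmax ↦ ?_⟩
  obtain ⟨M', a', r₁, hsub, -, hrp, -, hcol, hpar⟩ := Hε D hvac hdist 𝒟 hmax
  exact ⟨M', a', r₁, hsub, Kerr.futureEventHorizon_subset_collarBackground_domain hsub hrp, hcol,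
    hpar⟩

/-- **The new fact refines the one-sided rendering, at every order and oriented**: under the
fact, for every `k`, the conclusion shape of `klainerman_szeftel_kerr_stability_small_a_cauchy.nearness`
(`StabilityCauchy`: a region `𝒟oc` with `Spacetime.ConvergesToKerr 𝒟oc M' a' k`, sub-extremal
`(M', a')` within `η`, far-complete `𝓘⁺`) holds with, in addition, `𝒟oc ⊆ J⁺(ι X)` — a collar
chart restricts along `Kerr.exterior M' a' ≤ Kerr.region a' r₁` (`r₁ < r₊`) to an oriented
exterior chart (`CollarConvergesToKerr.exists_convergesToKerr_of_le`, `KerrCollarConvergence`).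
Klainerman–Szeftel 2023, Thm. 1.2.1 and Main Theorem §3.4.3. [cite: KlainermanSzeftel2023, Thm. 1.2.1; Main Theorem §3.4.3] -/
theorem klainerman_szeftel_kerr_stability_small_a_cauchy_collar.exists_convergesToKerr
    [Kerr.Facts] [Kerr.SliceFacts] (h : klainerman_szeftel_kerr_stability_small_a_cauchy_collar)
    (k : ℕ) :
    ∃ (s : ℕ) (δ : ℝ), ∃ a₀ > (0 : ℝ), ∀ (M a : ℝ) (hM : 0 < M), |a| < a₀ * M →
      ∀ r₀ ∈ Set.Ioo (Kerr.rMinus M a) (Kerr.rPlus M a), ∀ η > (0 : ℝ), ∃ ε > (0 : ℝ),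
        ∀ (D : InitialDataSet 𝓘(ℝ, E3) (Kerr.slice a r₀)) [D.metric.HasLeviCivita],
          D.IsVacuumConstraintSolution →
          InitialDataSet.dataWeightedSobolevEDist s δ D (Kerr.data M a r₀ hM.le) <
            ENNReal.ofReal ε →
          ∀ 𝒟 : VacuumCauchyDevelopment D, 𝒟.IsMaximal →
            ∃ (M' a' : ℝ) (𝒟oc : Set 𝒟.carrier), Kerr.IsSubextremal M' a' ∧
              |M' - M| + |a' - a| ≤ η ∧
              𝒟.HasCompleteFutureNullInfinityFar ∧
              𝒟oc ⊆ 𝒟.metric.causalFuture 𝒟.timeOrientation (range 𝒟.embed) ∧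
              𝒟.toSpacetime.ConvergesToKerr 𝒟oc M' a' k := by
  obtain ⟨s, δ, a₀, ha₀, H⟩ := h k
  refine ⟨s, δ, a₀, ha₀, fun M a hM ha r₀ hr₀ η hη ↦ ?_⟩
  obtain ⟨ε, hε, Hε⟩ := H M a hM ha r₀ hr₀ η hη
  refine ⟨ε, hε, fun D _ hvac hdist 𝒟 hmax ↦ ?_⟩
  obtain ⟨M', a', r₁, hsub, -, hrp, hfar, hcol, hpar⟩ := Hε D hvac hdist 𝒟 hmax
  obtain ⟨𝒟oc, hJ, hconv⟩ := hcol.exists_convergesToKerr_of_le hrp.le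
  exact ⟨M', a', 𝒟oc, hsub, hpar, hfar, hJ, hconv⟩

end Literature.Geometry.Lorentzian

end
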